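import Mathlib
import Literature.RepresentationTheory.FiniteGroups.CharacterDegrees
import Literature.RepresentationTheory.FiniteGroups.NonabelianCharDegree
import Literature.Barriers.MatrixMultiplication.QuasirandomBarrier
import Summits.MatrixMultiplication.MatrixMultiplication.Theorems.SnSubsetDichotomyPolynomialSlackInvolutions

/-!
# `PolynomialSlack` (stmt-MatrixMultiplication-8306): the second character degree of `S_n` grows linearly

Helper file 2/3 of the PRINT REGIME `C < 1/2` of the crux `SnSubsetDichotomy.PolynomialSlack` (line
`transport-split-hull`, lead c1). The standing Disproof (§3) and every line card use the print regime —
BCGPU 2023, Thm. 3.2 with `n(S_n) = n - 1` gives `|S||T||U|·n^C ≤ (n!)^{3/2}` for every `C < 1/2` — but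
the tree, which PROVES Thm. 3.2 (`BCGPU2023_thm32_holds`), has no lower bound for
`n(S_n) = secondCharDegree (Perm (Fin n))`. This file supplies a weak but sufficient one,
`⌊n/4⌋ ≤ n(S_n)` for `n ≥ 5`, by an elementary route (the exact value `n - 1`, Rasala 1977 /
James GTM 682 Thm. 2.4.10 via the branching rule, is not needed):

* `exists_elementary_two_subgroup_perm` — an injective homomorphism `(ℤ/2)^{⌊n/4⌋} → S_n`
  (independent double transpositions `(4i, 4i+1)(4i+2, 4i+3)`);
* `div_four_le_of_mem_charDegrees_perm` — every irreducible degree `> 1` of `S_n` is `≥ ⌊n/4⌋`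
  (faithfulness from file 1/3, then a faithful action of `(ℤ/2)^k` by commuting involutions needs
  dimension `≥ k`, `index_fixer_le_two_pow_finrank`);
* `div_four_le_secondCharDegree_perm` — `⌊n/4⌋ ≤ n(S_n)` (the infimum is attained by Serre's Thm. 9,
  tree theorem `Serre1977_thm9_holds`).
-/

namespace Summit.MatrixMultiplication.MatrixMultiplication.Theorems.PolynomialSlack

open Module

-- `Summit.<Summit>.<Problem>` is the tree's mandated summit-side namespace (CONVENTIONS §2); for
-- this single-conjunct summit the two coincide, so each declaration silences `dupNamespace`.
set_option linter.dupNamespace false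

/-! ## An elementary abelian `2`-subgroup of rank `⌊n/4⌋` -/

/-- **Independent double transpositions.** For every `n` there is an injective homomorphism from the
elementary abelian group `(ℤ/2)^{⌊n/4⌋}` (as `Multiplicative (Fin (n/4) → ZMod 2)`) into `S_n`: the
`i`-th coordinate acts as the double transposition `(4i, 4i+1)(4i+2, 4i+3)`, i.e. `x ↦ x xor 1` on the
block `{4i, …, 4i+3}`. [folklore] -/
theorem exists_elementary_two_subgroup_perm (n : ℕ) :
    ∃ ψ : Multiplicative (Fin (n / 4) → ZMod 2) →* Equiv.Perm (Fin n), Function.Injective ψ := by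
  classical
  set k := n / 4 with hk
  have hk4 : 4 * k ≤ n := by omega
  -- the flip on active blocks
  let act : (Fin k → ZMod 2) → Fin n → Prop := fun v x =>
    ∃ h : x.val < 4 * k, v ⟨x.val / 4, by omega⟩ = 1
  let flip : Fin n → Fin n := fun x =>
    if x.val % 2 = 0 then ⟨min (x.val + 1) (n - 1), by omega⟩ else ⟨x.val - 1, by omega⟩
  have flip_val : ∀ x : Fin n, x.val < 4 * k →
      (flip x).val = (if x.val % 2 = 0 then x.val + 1 else x.val - 1) := by
    intro x hx
    simp only [flip]
    split_ifs with h
    · dsimp only; omega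
    · rfl
  have flip_lt : ∀ x : Fin n, x.val < 4 * k → (flip x).val < 4 * k := by
    intro x hx; rw [flip_val x hx]; split_ifs <;> omega
  have flip_div : ∀ x : Fin n, x.val < 4 * k → (flip x).val / 4 = x.val / 4 := by
    intro x hx; rw [flip_val x hx]; split_ifs <;> omega
  have flip_flip : ∀ x : Fin n, x.val < 4 * k → flip (flip x) = x := by
    intro x hx
    apply Fin.ext
    have h1 := flip_val _ (flip_lt x hx)
    have h2 := flip_val x hx
    rw [h1]
    by_cases hpar : x.val % 2 = 0
    · rw [if_pos hpar] at h2
      rw [h2, if_neg (by omega)]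
      all_goals omega
    · rw [if_neg hpar] at h2
      rw [h2, if_pos (by omega)]
      all_goals omega
  have flip_ne : ∀ x : Fin n, x.val < 4 * k → flip x ≠ x := by
    intro x hx h
    have := congrArg Fin.val h
    rw [flip_val x hx] at this
    split_ifs at this <;> omega
  have act_flip : ∀ v x, act v (flip x) ↔ act v x := by
    intro v x
    constructor
    · rintro ⟨h, hv⟩
      have hx : x.val < 4 * k := by
        by_contra hx'
        simp only [flip] at h
        split_ifs at h with hpar
        · dsimp only at h; omega
        · dsimp only at h; omega
      refine ⟨hx, ?_⟩
      have e : (⟨(flip x).val / 4, by have := flip_lt x hx; omega⟩ : Fin k) = ⟨x.val / 4, by omega⟩ :=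
        Fin.ext (flip_div x hx)
      rw [e] at hv; exact hv
    · rintro ⟨hx, hv⟩
      refine ⟨flip_lt x hx, ?_⟩
      have e : (⟨(flip x).val / 4, by have := flip_lt x hx; omega⟩ : Fin k) = ⟨x.val / 4, by omega⟩ :=
        Fin.ext (flip_div x hx)
      rw [e]; exact hv
  -- the permutation attached to `v`
  let f : (Fin k → ZMod 2) → Fin n → Fin n := fun v x => if act v x then flip x else x
  have f_invol : ∀ v, Function.Involutive (f v) := by
    intro v x
    by_cases hx : act v x
    · have h1 : f v x = flip x := if_pos hx
      rw [h1]
      have h2 : act v (flip x) := (act_flip v x).2 hx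
      have h3 : f v (flip x) = flip (flip x) := if_pos h2
      rw [h3, flip_flip x hx.1]
    · have h1 : f v x = x := if_neg hx
      rw [h1, h1]
  let σ : (Fin k → ZMod 2) → Equiv.Perm (Fin n) := fun v => (f_invol v).toPerm _
  have σ_apply : ∀ v x, σ v x = f v x := fun v x => rfl
  have z2 : ∀ a b : ZMod 2, (a + b = 1) ↔ (a = 1 ↔ ¬ b = 1) := by decide
  have z2' : ∀ a : ZMod 2, a = 1 ∨ a = 0 := by decide
  -- multiplicativity
  have σ_mul : ∀ v w, σ (v + w) = σ v * σ w := by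
    intro v w
    ext x : 1
    rw [Equiv.Perm.mul_apply, σ_apply, σ_apply, σ_apply]
    by_cases hx : x.val < 4 * k
    · set i : Fin k := ⟨x.val / 4, by omega⟩ with hi
      have hact : ∀ u : Fin k → ZMod 2, ∀ y : Fin n, y.val < 4 * k → y.val / 4 = x.val / 4 →
          (act u y ↔ u i = 1) := by
        intro u y hy hyx
        constructor
        · rintro ⟨_, hu⟩
          have e : (⟨y.val / 4, by omega⟩ : Fin k) = i := Fin.ext (by simp [hi, hyx])
          rw [e] at hu; exact hu
        · intro hu
          have e : (⟨y.val / 4, by omega⟩ : Fin k) = i := Fin.ext (by simp [hi, hyx])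
          exact ⟨hy, by rw [e]; exact hu⟩
      have hxw : act w x ↔ w i = 1 := hact w x hx rfl
      have hxv : act v x ↔ v i = 1 := hact v x hx rfl
      have hfv : act v (flip x) ↔ v i = 1 := hact v (flip x) (flip_lt x hx) (flip_div x hx)
      have hvw : act (v + w) x ↔ (v + w) i = 1 := hact (v + w) x hx rfl
      simp only [f]
      rw [show (v + w) i = v i + w i from rfl] at hvw
      by_cases hw1 : w i = 1
      · rw [if_pos (hxw.2 hw1)]
        by_cases hv1 : v i = 1
        · rw [if_pos (hfv.2 hv1), flip_flip x hx, if_neg]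
          rw [hvw, z2]; tauto
        · rw [if_neg (fun h => hv1 (hfv.1 h)), if_pos]
          rw [hvw, z2]; tauto
      · rw [if_neg (fun h => hw1 (hxw.1 h))]
        by_cases hv1 : v i = 1
        · rw [if_pos (hxv.2 hv1), if_pos]
          rw [hvw, z2]; tauto
        · rw [if_neg (fun h => hv1 (hxv.1 h)), if_neg]
          rw [hvw, z2]
          rcases z2' (v i) with h | h
          · exact absurd h hv1
          · rcases z2' (w i) with h' | h'
            · exact absurd h' hw1
            · rw [h, h']; decide
    · have hnot : ∀ u : Fin k → ZMod 2, ¬ act u x := fun u ⟨h, _⟩ => hx h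
      simp only [f, if_neg (hnot _)]
  refine ⟨MonoidHom.mk' (fun v => σ (Multiplicative.toAdd v)) (fun v w => by
      show σ (Multiplicative.toAdd (v * w)) = σ (Multiplicative.toAdd v) * σ (Multiplicative.toAdd w)
      rw [toAdd_mul, σ_mul]), ?_⟩
  · intro v w hvw
    simp only [MonoidHom.mk'_apply] at hvw
    have key : ∀ u : Fin k → ZMod 2, σ u = σ 0 → u = 0 := by
      intro u hu
      funext i
      have hx : (⟨4 * i.val, by omega⟩ : Fin n).val < 4 * k := by dsimp only; omega
      have h := congrArg (fun π : Equiv.Perm (Fin n) => π ⟨4 * i.val, by omega⟩) hu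
      simp only [σ_apply, f] at h
      have h0 : ¬ act 0 ⟨4 * i.val, by omega⟩ := by
        rintro ⟨_, h'⟩; exact absurd h' (by rw [Pi.zero_apply]; decide)
      rw [if_neg h0] at h
      by_contra hui
      have hui1 : u i = 1 := by
        rcases z2' (u i) with h' | h'
        · exact h'
        · exact absurd h' hui
      have hact : act u ⟨4 * i.val, by omega⟩ := by
        refine ⟨hx, ?_⟩
        have e : (⟨(4 * i.val) / 4, by omega⟩ : Fin k) = i := Fin.ext (by simp)
        rw [e]; exact hui1
      rw [if_pos hact] at h
      exact flip_ne _ hx h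
    have : Multiplicative.toAdd (v / w) = 0 := by
      apply key
      rw [toAdd_div, sub_eq_add_neg, σ_mul, hvw, ← σ_mul, add_neg_cancel]
    rw [toAdd_div, sub_eq_zero] at this
    exact Multiplicative.toAdd.injective this

/-! ## The bound on the second character degree -/

/-- **Every irreducible character of `S_n` of degree `> 1` has degree `≥ ⌊n/4⌋`** (`n ≥ 5`; weak form
of the classical `n - 1`, Rasala 1977): the representation is faithful (`injective_of_isIrreducible_perm`),
so the rank-`⌊n/4⌋` elementary abelian `2`-subgroup acts faithfully by commuting involutions, and a
faithful such action needs dimension `≥` rank (`index_fixer_le_two_pow_finrank`). [folklore]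
-- TODO(general form): the minimal degree is exactly `n - 1` for `n ≥ 5` (branching rule). -/
theorem div_four_le_of_mem_charDegrees_perm {n : ℕ} (hn : 5 ≤ n) {d : ℕ}
    (hd : d ∈ Literature.RepresentationTheory.FiniteGroups.charDegrees (Equiv.Perm (Fin n)))
    (h1 : 1 < d) : n / 4 ≤ d := by
  obtain ⟨V, _, _, _, ρ, hρ, rfl⟩ := hd
  have hinj := injective_of_isIrreducible_perm hn ρ hρ h1
  obtain ⟨ψ, hψ⟩ := exists_elementary_two_subgroup_perm n
  let τ : Multiplicative (Fin (n / 4) → ZMod 2) →* Module.End ℂ V := ρ.comp ψ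
  have hinv : ∀ e, τ e * τ e = 1 := by
    intro e
    rw [← map_mul]
    have : e * e = 1 := by
      change Multiplicative.ofAdd (Multiplicative.toAdd e + Multiplicative.toAdd e) = 1
      have h2 : Multiplicative.toAdd e + Multiplicative.toAdd e = 0 := by
        funext i; rw [Pi.add_apply, Pi.zero_apply]; generalize Multiplicative.toAdd e i = a; revert a; decide
      rw [h2]; rfl
    rw [this, map_one]
  obtain ⟨K, hK, hKidx⟩ := index_fixer_le_two_pow_finrank τ hinv (finrank ℂ V) ⊤ (finrank_top ℂ V)
    (fun e w _ => Submodule.mem_top)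
  have hKbot : K = ⊥ := by
    rw [eq_bot_iff]
    intro e he
    rw [Subgroup.mem_bot]
    have hτ : τ e = 1 := by
      ext v
      exact (hK e).1 he v Submodule.mem_top
    have : ψ e = 1 := hinj (by rw [map_one]; exact hτ)
    exact hψ (by rw [this, map_one])
  rw [hKbot, Subgroup.index_bot, Nat.card_eq_fintype_card] at hKidx
  have hcardE : Fintype.card (Multiplicative (Fin (n / 4) → ZMod 2)) = 2 ^ (n / 4) := by
    rw [Fintype.card_multiplicative, Fintype.card_fun, ZMod.card, Fintype.card_fin]
  rw [hcardE] at hKidx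
  exact (Nat.pow_le_pow_iff_right (by norm_num)).1 hKidx

/-- **`⌊n/4⌋ ≤ n(S_n)`** for `n ≥ 5`, where `n(G) = secondCharDegree G` is BCGPU 2023's second-smallest
character degree (Def. 3.1): `S_n` is non-abelian, so by Serre's Thm. 9 (tree theorem
`Serre1977_thm9_holds`) some degree exceeds `1` and the infimum is attained. [folklore] -/
theorem div_four_le_secondCharDegree_perm {n : ℕ} (hn : 5 ≤ n) :
    n / 4 ≤ Literature.Barriers.MatrixMultiplication.secondCharDegree (Equiv.Perm (Fin n)) := by
  have hG : ∃ a b : Equiv.Perm (Fin n), a * b ≠ b * a := by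
    refine ⟨Equiv.swap ⟨0, by omega⟩ ⟨1, by omega⟩, Equiv.swap ⟨1, by omega⟩ ⟨2, by omega⟩, ?_⟩
    intro h
    have := congrArg (fun π : Equiv.Perm (Fin n) => (π ⟨0, by omega⟩ : Fin n).val) h
    simp [Equiv.swap_apply_def, Fin.ext_iff] at this
  obtain ⟨d, hd, h1⟩ :=
    Literature.RepresentationTheory.FiniteGroups.Serre1977_thm9_holds.exists_one_lt_mem_charDegrees
      (Equiv.Perm (Fin n)) hG
  have hne : {d : ℕ | d ∈ Literature.RepresentationTheory.FiniteGroups.charDegrees (Equiv.Perm (Fin n)) ∧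
      1 < d}.Nonempty := ⟨d, hd, h1⟩
  have hmem := Nat.sInf_mem hne
  exact div_four_le_of_mem_charDegrees_perm hn hmem.1 hmem.2

end Summit.MatrixMultiplication.MatrixMultiplication.Theorems.PolynomialSlack
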